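import Summits.CriticalPhenomena.PercolationContinuityZ3.Theorems.PercNearOneGluingNoHeavyQuantHeavySingleMixture
import HarnessLib

/-!
# QUANT lane R8, T-DEC: PRODUCT-MIXTURE CERTIFICATES FOR THE HEAVY-SINGLE SIBLING STEP — the interface by openness vectors (zeros =
# absent siblings), and THE WIDTH-3 TWO-POINT THEOREM: three moments `(E o₁, E o₂, E o₁o₂) = (q₁′, q₂′, q₁′q₂′)/q₁` of a two-point mixing law
# on the mean line certify the heavy single — the unbalanced side of arm-1 g52's width-3 theorem (arm-1 gen 53, architect)

builds on p205010 (kernel theorem, internal audit signed; external expert review pending)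

Support file (`--supports stmt-CriticalPhenomena-4575`), QUANT lane seat prim-quant-arm-1 (gen 53, architect); memo
`run/shared/lean/prim/quant/prim-quant-arm-1-g53/ARCH-G53.md` §2–§3.  Theorems only, standard axioms, no sorries.  Sequel of ✓ `…QuantHeavySingleMixture`
(`sdec_flaw_heavySingle_of_patterns`: the heavy-single step from any solution of the root-pattern moment problem).

* **`sdec_flaw_heavySingle_of_productMixture`** — the certificate as a finite family of OPENNESS VECTORS `o^c : positions → [0,1]` (a zero = the
  sibling is absent from that component; its support is the component's position set) with weights `λ_c`: floors `x ≤ s.q·o^c_i·x₁ᵢ` where `o^c_i ≠ 0`,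
  means `fmean L ≤ s.q·Σ_i o^c_i·mean ρᵢ`, and the PATTERN EQUATIONS `s.q·Σ_c λ_c·Π_{i∈A} o^c_i·Π_{i∉A}(1 − o^c_i) = Π_{i∈A} qᵢ·Π_{i∉A}(1 − qᵢ) −
  (1 − s.q)·[A = ∅]` for every position set `A` ⟹ `SDEC x (ftop (s :: L)) (flaw (s :: L))` (given the oracle).  (`fmean_subRegate_support`,
  `patternTerm_support`: with the support as position set the indicator form of `…HeavySingleMixture` is the plain product pattern.)
* `prodPattern_fin_two` (the four patterns of two positions), **`sdec_three_heavySingle_twoPoint`** — WIDTH 3: siblings `t₁, t₂` behind the single `s`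
  (`q₁ = s.q`), a two-point mixing law `{(a₁,a₂) w.p. λ; (b₁,b₂) w.p. 1−λ}` of openness pairs in `[0,1]²` with the THREE MOMENT EQUATIONS
  `s.q·(λa₁ + (1−λ)b₁) = t₁.q`, `s.q·(λa₂ + (1−λ)b₂) = t₂.q`, `s.q·(λa₁a₂ + (1−λ)b₁b₂) = t₁.q·t₂.q`, both points carrying the compound's mean
  (`fmean [t₁,t₂] ≤ s.q·(a₁m₁ + a₂m₂)`, same for `b`) and the floors (`aᵢ = 0 ∨ x ≤ s.q·aᵢ·x₁ᵢ`, same for `b`) ⟹ `SDEC x (ftop [s,t₁,t₂]) (flaw [s,t₁,t₂])`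
  given the oracle below `fgates [s,t₁,t₂]`.  ARCH-G53 §2: on the mean line the three moments are (mean `l₁`, variance `(1−s.q)·l₁l₂·m₂/m₁`), so such a
  law exists iff that variance is at most `max (l₁−a)(b−l₁)` over admissible `a ≤ l₁ ≤ b`; explicit `a = l₁ − V/(b − l₁)`, `λ = (b−l₁)/(b−a)`; the
  balanced U-RPM is `(a,b) = (0, m*/m₁)`; census: 64 % of random heavy-orientation triples at the true floor vs 43 % balanced (kit j268544).

HONEST STATUS: certificate interfaces + one explicit width-3 family; `SiblingStep`, `GateStepN`, `LightResidDECOracle`, `FarTreeRow` OPEN; RATE class (log\*) /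
honest sentence of `run/shared/lean/prim/quant/README.md` unchanged.  [this work].  Nothing here is cited as a published result.  The gluing rows served
[cite: KozmaNitzan2024, Conjecture 3 (p. 15)]; product measure [cite: Grimmett1999, §1.3 p. 10].
-/

noncomputable section

open scoped BigOperators

namespace Summit.CriticalPhenomena.PercolationContinuityZ3.Theorems
namespace Quant
namespace LawDec

open Finset URPM

/-! ### The interface by openness vectors -/

/-- the gated mean of the sub-forest re-gated on the SUPPORT of an openness vector is `Σ_i oᵢ·mean ρᵢ` over all positions. [this work] -/
theorem fmean_subRegate_support (L : List Sib) (o : Fin L.length → ℝ) :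
    fmean (subRegate L (Finset.univ.filter fun i => o i ≠ 0) o) = ∑ i, o i * (L.get i).mean := by
  classical
  rw [fmean_subRegate, Finset.sum_filter]
  refine Finset.sum_congr rfl fun i _ => ?_
  split_ifs with h
  · rfl
  · rw [not_not.1 h, zero_mul]

/-- with the support as position set, the indicator pattern term is the plain product pattern. [this work] -/
theorem patternTerm_support (L : List Sib) (o : Fin L.length → ℝ) (A : Finset (Fin L.length)) :
    (if A ⊆ Finset.univ.filter (fun i => o i ≠ 0) then (∏ i ∈ A, o i) * ∏ i ∈ Finset.univ.filter (fun i => o i ≠ 0) \ A, (1 - o i) else 0)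
      = (∏ i ∈ A, o i) * ∏ i ∈ Finset.univ \ A, (1 - o i) := by
  classical
  by_cases hA : A ⊆ Finset.univ.filter (fun i => o i ≠ 0)
  · rw [if_pos hA]
    congr 1
    apply Finset.prod_subset (Finset.sdiff_subset_sdiff (Finset.filter_subset _ _) le_rfl)
    intro i hi hni
    have hiA : i ∉ A := (Finset.mem_sdiff.1 hi).2
    have hi0 : ¬ (o i ≠ 0) := fun h => hni (Finset.mem_sdiff.2 ⟨Finset.mem_filter.2 ⟨Finset.mem_univ i, h⟩, hiA⟩)
    rw [not_not.1 hi0, sub_zero]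
  · rw [if_neg hA]
    obtain ⟨i, hiA, hi⟩ := Finset.not_subset.1 hA
    have hi0 : o i = 0 := by
      by_contra h
      exact hi (Finset.mem_filter.2 ⟨Finset.mem_univ i, h⟩)
    rw [Finset.prod_eq_zero hiA hi0, zero_mul]

/-- **THE HEAVY-SINGLE SIBLING STEP FROM A PRODUCT-MIXTURE CERTIFICATE GIVEN BY OPENNESS VECTORS** (zeros allowed = absent siblings).
[this work] -/
theorem sdec_flaw_heavySingle_of_productMixture {x : ℝ} (hx0 : 0 < x) (hx1 : x < 1) (s : Sib) (L : List Sib)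
    (hs : s.TreeOK x) (hL : ∀ t ∈ L, t.TreeOK x)
    (hO : ∀ (x' : ℝ) (n' M' : ℕ) (μ' : ℕ → ℝ), n' < fgates (s :: L) → TreeBuiltN x' n' M' μ' → SDEC x' M' μ')
    {C : Type*} [Fintype C] (lam : C → ℝ) (o : C → Fin L.length → ℝ)
    (hlam0 : ∀ c, 0 ≤ lam c) (hlam1 : ∑ c, lam c = 1) (ho0 : ∀ c i, 0 ≤ o c i) (ho1 : ∀ c i, o c i ≤ 1)
    (hfl : ∀ c i, 0 < lam c → o c i ≠ 0 → x ≤ s.q * (o c i * (L.get i).x₁))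
    (hmean : ∀ c, 0 < lam c → fmean L ≤ s.q * ∑ i, o c i * (L.get i).mean)
    (hpat : ∀ A : Finset (Fin L.length),
      s.q * ∑ c, lam c * ((∏ i ∈ A, o c i) * ∏ i ∈ Finset.univ \ A, (1 - o c i))
        = (∏ i ∈ A, (L.get i).q) * (∏ i ∈ Finset.univ \ A, (1 - (L.get i).q)) - (1 - s.q) * (if A = ∅ then 1 else 0)) :
    SDEC x (ftop (s :: L)) (flaw (s :: L)) := by
  classical
  refine sdec_flaw_heavySingle_of_patterns hx0 hx1 s L hs hL hO lam (fun c => Finset.univ.filter fun i => o c i ≠ 0) o hlam0 hlam1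
    ?_ ?_ ?_
  · intro c hc i hi
    have hi0 : o c i ≠ 0 := (Finset.mem_filter.1 hi).2
    exact ⟨lt_of_le_of_ne (ho0 c i) (Ne.symm hi0), ho1 c i, hfl c i hc hi0⟩
  · intro c hc
    rw [fmean_subRegate_support]
    exact hmean c hc
  · intro A
    rw [← hpat A]
    congr 1
    exact Finset.sum_congr rfl fun c _ => by rw [patternTerm_support]

/-! ### Width 3: the two-point theorem -/

/-- the four subsets of two positions. [this work] -/
theorem finset_fin_two (A : Finset (Fin 2)) : A = ∅ ∨ A = {0} ∨ A = {1} ∨ A = {0, 1} := by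
  revert A; decide

/-- **the pattern probabilities of a product on two positions**: `Π_{i∈A} oᵢ · Π_{i∉A} (1 − oᵢ) = [o₀ or 1−o₀]·[o₁ or 1−o₁]`. [this work] -/
theorem prodPattern_fin_two (o : Fin 2 → ℝ) (A : Finset (Fin 2)) :
    (∏ i ∈ A, o i) * ∏ i ∈ Finset.univ \ A, (1 - o i)
      = (if (0 : Fin 2) ∈ A then o 0 else 1 - o 0) * (if (1 : Fin 2) ∈ A then o 1 else 1 - o 1) := by
  have h0 : (Finset.univ : Finset (Fin 2)) \ ∅ = {0, 1} := by decide
  have h1 : (Finset.univ : Finset (Fin 2)) \ {0} = {1} := by decide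
  have h2 : (Finset.univ : Finset (Fin 2)) \ {1} = {0} := by decide
  have h3 : (Finset.univ : Finset (Fin 2)) \ {0, 1} = ∅ := by decide
  rcases finset_fin_two A with rfl | rfl | rfl | rfl
  · rw [h0]; simp
  · rw [h1]; simp
  · rw [h2]; simp [mul_comm]
  · rw [h3]; simp

/-- **THE WIDTH-3 TWO-POINT THEOREM (heavy single, variance criterion).**  Floor `0 < x < 1`; tree-built siblings `s` (the single, `q₁ = s.q`), `t₁`,
`t₂`; the oracle below `fgates [s, t₁, t₂]`; a two-point mixing law — weight `λ ∈ [0,1]`, openness pairs `(a₁,a₂)`, `(b₁,b₂) ∈ [0,1]²` — with the three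
moment equations `s.q·(λa₁ + (1−λ)b₁) = t₁.q`, `s.q·(λa₂ + (1−λ)b₂) = t₂.q`, `s.q·(λa₁a₂ + (1−λ)b₁b₂) = t₁.q·t₂.q`, both points carrying the compound's
gated mean (`fmean [t₁,t₂] ≤ s.q·(a₁·mean t₁ + a₂·mean t₂)`, same for `b`; needed only for the genuine points) and respecting the floors (`aᵢ = 0` or
`x ≤ s.q·aᵢ·x₁ᵢ`, same for `b`) ⟹ `SDEC x (ftop [s, t₁, t₂]) (flaw [s, t₁, t₂])`. [this work] -/
theorem sdec_three_heavySingle_twoPoint {x : ℝ} (hx0 : 0 < x) (hx1 : x < 1) (s t₁ t₂ : Sib)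
    (hs : s.TreeOK x) (ht₁ : t₁.TreeOK x) (ht₂ : t₂.TreeOK x)
    (hO : ∀ (x' : ℝ) (n' M' : ℕ) (μ' : ℕ → ℝ), n' < fgates [s, t₁, t₂] → TreeBuiltN x' n' M' μ' → SDEC x' M' μ')
    (lam a₁ a₂ b₁ b₂ : ℝ) (hlam0 : 0 ≤ lam) (hlam1 : lam ≤ 1)
    (ha₁0 : 0 ≤ a₁) (ha₁1 : a₁ ≤ 1) (ha₂0 : 0 ≤ a₂) (ha₂1 : a₂ ≤ 1) (hb₁0 : 0 ≤ b₁) (hb₁1 : b₁ ≤ 1) (hb₂0 : 0 ≤ b₂) (hb₂1 : b₂ ≤ 1)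
    (e1 : s.q * (lam * a₁ + (1 - lam) * b₁) = t₁.q) (e2 : s.q * (lam * a₂ + (1 - lam) * b₂) = t₂.q)
    (e3 : s.q * (lam * (a₁ * a₂) + (1 - lam) * (b₁ * b₂)) = t₁.q * t₂.q)
    (hma : 0 < lam → fmean [t₁, t₂] ≤ s.q * (a₁ * t₁.mean + a₂ * t₂.mean))
    (hmb : lam < 1 → fmean [t₁, t₂] ≤ s.q * (b₁ * t₁.mean + b₂ * t₂.mean))
    (hfa₁ : 0 < lam → a₁ ≠ 0 → x ≤ s.q * (a₁ * t₁.x₁)) (hfa₂ : 0 < lam → a₂ ≠ 0 → x ≤ s.q * (a₂ * t₂.x₁))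
    (hfb₁ : lam < 1 → b₁ ≠ 0 → x ≤ s.q * (b₁ * t₁.x₁)) (hfb₂ : lam < 1 → b₂ ≠ 0 → x ≤ s.q * (b₂ * t₂.x₁)) :
    SDEC x (ftop [s, t₁, t₂]) (flaw [s, t₁, t₂]) := by
  classical
  have hL : ∀ t ∈ [t₁, t₂], t.TreeOK x := by
    intro t ht
    simp only [List.mem_cons, List.mem_nil_iff, or_false] at ht
    rcases ht with rfl | rfl
    · exact ht₁
    · exact ht₂
  -- the four pattern equations on two positions, from the three moments
  have key : ∀ A : Finset (Fin 2),
      s.q * (lam * ((∏ i ∈ A, (![a₁, a₂] : Fin 2 → ℝ) i) * ∏ i ∈ Finset.univ \ A, (1 - (![a₁, a₂] : Fin 2 → ℝ) i))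
        + (1 - lam) * ((∏ i ∈ A, (![b₁, b₂] : Fin 2 → ℝ) i) * ∏ i ∈ Finset.univ \ A, (1 - (![b₁, b₂] : Fin 2 → ℝ) i)))
      = (∏ i ∈ A, (![t₁.q, t₂.q] : Fin 2 → ℝ) i) * (∏ i ∈ Finset.univ \ A, (1 - (![t₁.q, t₂.q] : Fin 2 → ℝ) i))
        - (1 - s.q) * (if A = ∅ then 1 else 0) := by
    intro A
    rw [prodPattern_fin_two, prodPattern_fin_two, prodPattern_fin_two]
    rcases finset_fin_two A with rfl | rfl | rfl | rfl
    · simp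
      linear_combination e3 - e1 - e2
    · simp
      linear_combination e1 - e3
    · simp
      linear_combination e2 - e3
    · simp
      linear_combination e3
  refine sdec_flaw_heavySingle_of_productMixture hx0 hx1 s [t₁, t₂] hs hL hO (C := Fin 2) ![lam, 1 - lam]
    ![(![a₁, a₂] : Fin 2 → ℝ), (![b₁, b₂] : Fin 2 → ℝ)] ?_ ?_ ?_ ?_ ?_ ?_ ?_
  · intro c; fin_cases c <;> simp [hlam0, hlam1]
  · simp [Fin.sum_univ_two]
  · intro c i; fin_cases c <;> fin_cases i <;> simp [ha₁0, ha₂0, hb₁0, hb₂0]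
  · intro c i; fin_cases c <;> fin_cases i <;> simp [ha₁1, ha₂1, hb₁1, hb₂1]
  · intro c i hc hi
    fin_cases c <;> fin_cases i
    · exact hfa₁ (by simpa using hc) (by simpa using hi)
    · exact hfa₂ (by simpa using hc) (by simpa using hi)
    · exact hfb₁ (by simp at hc; linarith) (by simpa using hi)
    · exact hfb₂ (by simp at hc; linarith) (by simpa using hi)
  · intro c hc
    fin_cases c
    · have h := hma (by simpa using hc)
      simpa [Fin.sum_univ_two] using h
    · have h := hmb (by simp at hc; linarith)
      simpa [Fin.sum_univ_two] using h
  · intro A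
    have hget : ∀ i : Fin [t₁, t₂].length, ([t₁, t₂].get i).q = (![t₁.q, t₂.q] : Fin 2 → ℝ) i := by
      intro i; fin_cases i <;> rfl
    simp_rw [hget]
    rw [Fin.sum_univ_two]
    simp only [Matrix.cons_val_zero, Matrix.cons_val_one, Matrix.cons_val_fin_one]
    exact key A

end LawDec
end Quant
end Summit.CriticalPhenomena.PercolationContinuityZ3.Theorems
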